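import Summits.QuantumFields.QCD.Theses.NestedDissectionSea
import Summits.QuantumFields.QCD.Theorems.NegativeCellsDilute.Negative.CellPositivity

/-!
# Stub `stub_defectCrossing` of line `mass-wegner-cell-index`
(crux `Summit.QuantumFields.QCD.Theses.NestedDissectionSea.NegativeCellsDilute`, item stmt-QuantumFields-13900)

**A sign defect forces a crossing at or above the mass** (= the body of route support
`SignDefectForcesCrossing`, stmt-QuantumFields-13898, verbatim): if the corner-`0` box of sides `s` is a
sign defect at bare mass `μ` and scale `j` (`IsSignDefect U μ j s`), then some Dirichlet cell among
{parent, sixteen children} has `det = 0` at a bare mass `μ₀ ≥ μ` (indeed `μ₀ ∈ (μ, 1)`).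

Proof.  Every Dirichlet cell matrix is a principal block of the Wilson–Dirac matrix,
`wilsonCell U t x s = toSquareBlockProp (D_W(U, t, 1)) (wilsonBox x s)` (by `rfl`), and the bare mass
enters `D_W` as `+ t • 1` (`D_W(U, t, 1) = (t + 4)·1 − Σ_ν W_ν`, tree lemma
`wilsonDirac_eq_sub_sum_wilsonHop`).  Hence `t ↦ det (D_W(U, t, 1)|_p)` is continuous; it is real
(landed `NegativeCellsDiluteCellPositivity.block_det_im`) and has positive real part at every `t > 0`
(landed `NegativeCellsDiluteCellPositivity.block_det_re_pos`).  A negative real part at `μ` therefore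
forces `μ < 1` and, by the intermediate value theorem on `[μ, 1]`, a zero of the (real) determinant in
`(μ, 1)`.  At the leaf scale the parent determinant is negative; at `j > 0` the negative 17-fold product
`d(parent) · Π_ε d(child ε)` has a negative factor.  Adapted from the standing disprover's work file
`Cruxes/NegativeCellsDilute/Disproof.lean`, § 6 (`signDefectForcesCrossing`).
No unproved named facts are used.
-/

noncomputable section

namespace Summit.QuantumFields.QCD.Cruxes.NegativeCellsDilute.MassWegnerCellIndex

open scoped BigOperators
open Matrix
open Literature.MathematicalPhysics.QuantumLattice Literature.MathematicalPhysics.QuantumFieldTheory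
  Literature.Probability.LatticeModels
open Summit.QuantumFields.QCD.Theorems.NegativeCellsDiluteCellPositivity (fund_unitary block_det_im
  block_det_re_pos)

section Crossing

variable {L N : ℕ} [NeZero L] {G : Type*} [Group G] (ρ : G →* Matrix (Fin N) (Fin N) ℂ)

omit [NeZero L] in
/-- The mass enters the Wilson–Dirac matrix as `+ t • 1` (from `D_W = (m+4)·1 − Σ_ν W_ν`). -/
private theorem defectCrossing_wilsonDirac_eq_add_smul_one
    (hρ : ∀ g, ρ g ∈ Matrix.unitaryGroup (Fin N) ℂ) (U : GaugeConfig 4 L G) (t : ℝ) :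
    wilsonDirac ρ U t 1 = wilsonDirac ρ U 0 1 + ((t : ℂ)) • (1 : Matrix _ _ ℂ) := by
  rw [wilsonDirac_eq_sub_sum_wilsonHop ρ hρ, wilsonDirac_eq_sub_sum_wilsonHop ρ hρ,
    show ((t + 4 : ℝ) : ℂ) = ((0 + 4 : ℝ) : ℂ) + (t : ℂ) by push_cast; ring, add_smul]
  abel

omit [NeZero L] in
/-- `t ↦ D_W(U, t, 1)` is continuous (affine in the mass). -/
private theorem defectCrossing_continuous_wilsonDirac_mass
    (hρ : ∀ g, ρ g ∈ Matrix.unitaryGroup (Fin N) ℂ) (U : GaugeConfig 4 L G) :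
    Continuous fun t : ℝ => wilsonDirac ρ U t 1 := by
  have h : (fun t : ℝ => wilsonDirac ρ U t 1) =
      fun t : ℝ => wilsonDirac ρ U 0 1 + ((t : ℂ)) • (1 : Matrix _ _ ℂ) := by
    funext t; exact defectCrossing_wilsonDirac_eq_add_smul_one ρ hρ U t
  rw [h]
  exact continuous_const.add (Complex.continuous_ofReal.smul continuous_const)

/-- `t ↦ det (D_W(U, t, 1)|_p)` is continuous, for every principal block `p`. -/
private theorem defectCrossing_continuous_blockDet_mass
    (hρ : ∀ g, ρ g ∈ Matrix.unitaryGroup (Fin N) ℂ) (U : GaugeConfig 4 L G)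
    (p : TorusSite 4 L × Fin N × Fin 4 → Prop) [DecidablePred p] :
    Continuous fun t : ℝ => (toSquareBlockProp (wilsonDirac ρ U t 1) p).det := by
  have h : Continuous fun t : ℝ => toSquareBlockProp (wilsonDirac ρ U t 1) p :=
    (defectCrossing_continuous_wilsonDirac_mass ρ hρ U).matrix_submatrix _ _
  exact h.matrix_det

/-- **A negative principal minor forces a singular block at a larger mass.** If
`Re det (D_W(U, μ, 1)|_p) < 0` then `det (D_W(U, μ', 1)|_p) = 0` for some `μ' ∈ (μ, 1)`: the minor
is real (`block_det_im`), continuous in the mass, and positive at mass `1` (`block_det_re_pos`);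
intermediate value theorem. -/
private theorem defectCrossing_exists_blockDet_eq_zero_of_re_neg
    (hρ : ∀ g, ρ g ∈ Matrix.unitaryGroup (Fin N) ℂ) (U : GaugeConfig 4 L G) {μ : ℝ}
    (p : TorusSite 4 L × Fin N × Fin 4 → Prop) [DecidablePred p]
    (hneg : (toSquareBlockProp (wilsonDirac ρ U μ 1) p).det.re < 0) :
    ∃ μ' : ℝ, μ < μ' ∧ μ' < 1 ∧ (toSquareBlockProp (wilsonDirac ρ U μ' 1) p).det = 0 := by
  set g : ℝ → ℝ := fun t => (toSquareBlockProp (wilsonDirac ρ U t 1) p).det.re with hgdef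
  have hg : Continuous g :=
    Complex.continuous_re.comp (defectCrossing_continuous_blockDet_mass ρ hρ U p)
  have hμ1 : μ < 1 := by
    by_contra h
    have hpos := block_det_re_pos ρ hρ U (lt_of_lt_of_le one_pos (not_lt.mp h)) p
    exact absurd hneg (not_lt.mpr hpos.le)
  have hg1 : 0 < g 1 := block_det_re_pos ρ hρ U one_pos p
  have hmem : (0 : ℝ) ∈ Set.Ioo (g μ) (g 1) := ⟨hneg, hg1⟩
  obtain ⟨t, ht, ht0⟩ := intermediate_value_Ioo hμ1.le hg.continuousOn hmem
  refine ⟨t, ht.1, ht.2, ?_⟩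
  exact Complex.ext (by simpa [hgdef] using ht0) (by simpa using block_det_im ρ hρ U t p)

end Crossing

/-- A negative product of reals has a negative factor: either the head or one in the product. -/
private theorem defectCrossing_neg_factor_of_mul_prod_neg {ι : Type*} [Fintype ι] {a : ℝ}
    {f : ι → ℝ} (h : a * ∏ i, f i < 0) : a < 0 ∨ ∃ i, f i < 0 := by
  rcases lt_or_ge a 0 with ha | ha
  · exact Or.inl ha
  · right
    by_contra hcon
    have hf : ∀ i, 0 ≤ f i := fun i => not_lt.mp fun hi => hcon ⟨i, hi⟩
    exact absurd h (not_lt.mpr (mul_nonneg ha (Finset.prod_nonneg fun i _ => hf i)))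

/-- **Stub 1a — `defectCrossing` (a sign defect forces a crossing at or above the mass).**
Verbatim the body of route support `SignDefectForcesCrossing` (stmt-QuantumFields-13898): if the
corner-`0` box of sides `s` is a sign defect at bare mass `μ` and scale `j`, some cell among
{parent, 16 children} has `det = 0` at a bare mass `μ₀ ≥ μ`.  Each `t ↦ det wilsonCell U t x s'` is
real (`NegativeCellsDiluteCellPositivity.block_det_im`), continuous (affine in `t`), with positive
real part at `t = 1` (`block_det_re_pos`); a negative leaf determinant or a negative 17-fold product
has a negative factor; intermediate value theorem. -/
theorem stub_defectCrossing :
    ∀ (N : ℕ) [NeZero N] (U : GaugeConfig 4 N (Matrix.specialUnitaryGroup (Fin 3) ℂ)) (μ : ℝ) (j : ℕ)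
      (s : Fin 4 → ℕ), IsSignDefect U μ j s →
      ∃ μ₀ : ℝ, μ ≤ μ₀ ∧ ((wilsonCell U μ₀ 0 s).det = 0 ∨
        ∃ c : Fin 4 → Bool, (wilsonCell U μ₀ (halfCorner s c) (halfSides s c)).det = 0) := by
  intro N _ U μ j s hdef
  rcases hdef with ⟨-, hneg⟩ | ⟨-, hneg⟩
  · obtain ⟨μ', h1, -, h0⟩ :=
      defectCrossing_exists_blockDet_eq_zero_of_re_neg (fundamentalRep (Fin 3)) fund_unitary U
        (wilsonBox 0 s) hneg
    exact ⟨μ', h1.le, Or.inl h0⟩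
  · rcases defectCrossing_neg_factor_of_mul_prod_neg hneg with hpar | ⟨ε, hch⟩
    · obtain ⟨μ', h1, -, h0⟩ :=
        defectCrossing_exists_blockDet_eq_zero_of_re_neg (fundamentalRep (Fin 3)) fund_unitary U
          (wilsonBox 0 s) hpar
      exact ⟨μ', h1.le, Or.inl h0⟩
    · obtain ⟨μ', h1, -, h0⟩ :=
        defectCrossing_exists_blockDet_eq_zero_of_re_neg (fundamentalRep (Fin 3)) fund_unitary U
          (wilsonBox (halfCorner s ε) (halfSides s ε)) hch
      exact ⟨μ', h1.le, Or.inr ⟨ε, h0⟩⟩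

end Summit.QuantumFields.QCD.Cruxes.NegativeCellsDilute.MassWegnerCellIndex

end
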